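import Mathlib
import HarnessLib
import Summits.HubbardSuperconductivity.HubbardSuperconductivity.Theorems.KLProgrammeKLRegimeSplitPairArrayExtra
import Summits.HubbardSuperconductivity.HubbardSuperconductivity.Theorems.KLProgrammeKLRegimeBetaSplitClauses

/-!
# Route `KLProgramme` — crux K3, child 1 `BetaSplitP` for EVERY bundle whose engine slot yields the two pair clauses around ANY (T)/(D)
# extra-majorant family with quadratic sizes: `betaSplitP_of_extraClauses` (the count- and profile-independent closer; V7 and V8 are instances)

Cell gate-hubbard-kl, seat hubbard-kl-k3c1-p2 (child-1 row).  r2d-p1's `betaSplitP_of_clauses` (`…KLRegimeBetaSplitClauses`) made child 1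
robust to re-stagings of the engine conjuncts it does not read; the conjuncts it DOES read — (E2-v5) `PairLadderStepAtV5` and (E2″-v5)
`PairValueIncrementAtV5` — were then re-staged themselves (Δ16, plan g10 16:35Z: the leg count `legSliceCount ↦ legSliceCountT`, bundle V8;
earlier Δ15: `legDressBar ↦ legDressBarQ`; (T): `thermalBar`).  Child 1 reads those majorants only through three numbers: a per-scale size and
two per-entry scale sums.  This file closes child 1 ONCE for an ABSTRACT family
`𝔛 L G P Q β U μ K j Qm k k' ≥ 0` with `𝔛 ≤ sG·CF·(Klam U)² + sQ·CR·Klam³·U²` per scale and `Σ_scales 𝔛 ≤ tG·CF·(Klam U)² + tQ·CR·Klam³·U²` per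
entry (numerals `sG sQ tG tQ ≥ 0` with `8(tQ + sQ) + tQ ≤ klLegKappa = 4000`), the engine slot being asked for the EXPANDED pair clauses with
remainder `drivePBar + ē + 𝔛` (ladder) / `gainBar + ē + 𝔛` (increment), (E4) `EngineFirstMoments` and (E5-S) `IsoTupleL1AtS`, and the split slot
implied by `BetaSplitAtS2`.  Constants (generalising r2d-p1's): `P = (2CF+3, C_W, cE4+1, 0)` with
`C_W = 8(Σ_χ(abot+atop)+1) + 17(aplus Klam² Z + cloc Klam²(1−4^{−θ})⁻¹ + 1) + 1 + (8(tG+sG)+3+tG)·CF·Klam²`; no-onset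
`c₀ = ln 4/(160·Crow·(bhi+1))`, `Crow = (Σ_χ(abot+atop)+1) + 2(aplus Klam² Z + cloc Klam²(1−4^{−θ})⁻¹ + 1) + 1 + (tG+sG)·CF·Klam² + (tQ+sQ)·CR·Klam³`;
`U₀ = min(1, 1/(2CR Klam³+1), 1/(Q.cE4+1), 1/(Dval+1))`, `Dval = C′ + CF·C′ + CF·Klam²`, `C′ = C_W + klLegKappa·CR·Klam³`; `L₁ β U = ⌈17 Σ_{j≤n_β} CL β j/U²⌉₊`.
The V5/V7 texts are the instance `(sG,sQ,tG,tQ) = (1,8,4/3,40)`, `𝔛 = thermalBar + legDressBarQ·legSliceCount` (re-deriving the landed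
`betaSplitP_klPredsV7` through `betaSplitP_of_extraClauses` elaborates — checked seat-side, HOME/hubbard-kl-k3c1-p2/BetaSplitExtra_withV7instance.lean;
not landed again: the statement is already in the tree); the V8 texts differ only in the count (`legSliceCountT`) and close by the same numerals
once `legSliceCountT_le_four/_sum_le` are in the tree.  Everything is proved; no definitions.
-/

noncomputable section

namespace Summit.HubbardSuperconductivity.HubbardSuperconductivity.Theorems.KLRegimeSplit

set_option linter.dupNamespace false -- summit = problem name (single-conjunct summit), D-0017

open Real Finset Literature.MathematicalPhysics.QuantumLattice Literature.Probability.LatticeModels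
open Summit.HubbardSuperconductivity.HubbardSuperconductivity.Theorems.KLProgrammeLegKernels
open Summit.HubbardSuperconductivity.HubbardSuperconductivity.Theorems.CooperChannelRiccatiFlow
open Summit.HubbardSuperconductivity.HubbardSuperconductivity.Theorems.DispersionFlow

section Model

variable (L M : ℕ) [NeZero L] [NeZero M]

variable {G : GeoConsts} {P : SplitConsts} {Qc : EngConsts}

set_option maxHeartbeats 400000 in -- polynomial bookkeeping (`nlinarith` on ~10 atoms); pre-empted per the cell's heartbeat rule
/-- **Row 0′ with the constants chosen, GENERIC in the extra family.**  Numerals `sG sQ tG tQ ≥ 0` with `8(tQ+sQ)+tQ ≤ klLegKappa`; an extra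
majorant `X j Qm k k' ≥ 0` with `X ≤ sG·CF(Klam U)² + sQ·CR·Klam³·U²` per scale and both scale sums `≤ tG·CF(Klam U)² + tQ·CR·Klam³·U²`; the UV
clause, the expanded ladder / increment clauses at `1 ≤ j ≤ n`; `U ≥ 0`, `2·CR·Klam³·|U| ≤ 1`, the volume line `17·Σ_{j<n} CL β j/L ≤ U²`,
the NO-ONSET line `160·((Σ_χ(abot+atop)+1) + 2(aplus Klam² Z + cloc Klam²(1−4^{−θ})⁻¹ + 1) + 1 + (tG+sG)·CF·Klam² + (tQ+sQ)·CR·Klam³)·U²·(bhi·n) ≤ 1`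
and `8(Σ_χ(abot+atop)+1) + 17(aplus Klam² Z + cloc Klam²(1−4^{−θ})⁻¹ + 1) + 1 + (8(tG+sG)+3+tG)·CF·Klam² ≤ P.C_W` give `PairArrayAtV2 L M P Q β U μ K n`. -/
theorem pairArrayAtV2_of_extraClauses_explicit (hG : G.WF) (hP : P.WF) (hQc : Qc.WF) {β U μ : ℝ} {K : TrigPolyC4v}
    (hU : 0 ≤ U) {n : ℕ} {sG sQ tG tQ : ℝ} (hsG : 0 ≤ sG) (hsQ : 0 ≤ sQ) (htG : 0 ≤ tG) (htQ : 0 ≤ tQ)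
    (hκ : 8 * (tQ + sQ) + tQ ≤ klLegKappa)
    (X : ℕ → TorusSite 2 L → TorusSite 2 L → TorusSite 2 L → ℝ) (hX0 : ∀ j Qm k k', 0 ≤ X j Qm k k')
    (hXsup : ∀ j Qm k k', X j Qm k k' ≤ sG * (G.CF * (P.Klam * U) ^ 2) + sQ * (Qc.CR * P.Klam ^ 3 * U ^ 2))
    (hXsum : ∀ (t : ℕ) (Qm k k' : TorusSite 2 L),
      ∑ j ∈ Ioc t n, X j Qm k k' ≤ tG * (G.CF * (P.Klam * U) ^ 2) + tQ * (Qc.CR * P.Klam ^ 3 * U ^ 2))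
    (hXtot : ∀ Qm k k' : TorusSite 2 L,
      ∑ i ∈ range n, X (i + 1) Qm k k' ≤ tG * (G.CF * (P.Klam * U) ^ 2) + tQ * (Qc.CR * P.Klam ^ 3 * U ^ 2))
    (h0 : ∀ Qm : TorusSite 2 L, ∀ k ∈ klBall L μ K, ∀ k' ∈ klBall L μ K,
      ‖klPairAmplitude L M β U μ K 0 Qm k k' - (U : ℂ)‖ ≤ initDevBar G U)
    (hsteps : ∀ j, 1 ≤ j → j ≤ n → ∀ Qm : TorusSite 2 L, IsPairClassAt L Qm j →
      ∃ w : TorusSite 2 L → ℝ, (∀ p, 0 ≤ w p) ∧ (∑ p, w p ≤ G.bhi) ∧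
        ∃ N : Matrix (TorusSite 2 L) (TorusSite 2 L) ℂ,
          (1 + Matrix.diagonal (fun p => (w p : ℂ)) * klPairArray L M β U μ K (j - 1) Qm) * N = 1 ∧
          ∀ k ∈ klBall L μ K, ∀ k' ∈ klBall L μ K,
            ‖klPairAmplitude L M β U μ K j Qm k k' - (klPairArray L M β U μ K (j - 1) Qm * N) k k'‖ ≤
              drivePBar G P U (j - 1) + eremBar G P Qc U β L (j - 1) + X j Qm k k')
    (hincr : ∀ j, 1 ≤ j → j ≤ n → ∀ Qm : TorusSite 2 L, ∀ k ∈ klBall L μ K, ∀ k' ∈ klBall L μ K,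
      ‖klPairAmplitude L M β U μ K j Qm k k' - klPairAmplitude L M β U μ K (j - 1) Qm k k'‖ ≤
        gainBar G P U j (klTorusNorm L Qm) (klTorusNorm L (k - k')) (klTorusNorm L (k + k' - Qm)) +
          eremBar G P Qc U β L (j - 1) + X j Qm k k')
    (hUCR : 2 * Qc.CR * P.Klam ^ 3 * |U| ≤ 1) (hL : 17 * ∑ j ∈ range n, Qc.CL β j / L ≤ U ^ 2)
    (hsmall : 8 * 20 * (((∑ χ : D4Irrep, (G.abot χ + G.atop χ) + 1) +
        2 * (G.aplus * P.Klam ^ 2 * G.Z + G.cloc * P.Klam ^ 2 * (1 - (4 : ℝ) ^ (-G.θ))⁻¹ + 1) + 1 +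
          (tG + sG) * (G.CF * P.Klam ^ 2) + (tQ + sQ) * (Qc.CR * P.Klam ^ 3)) * U ^ 2) * (G.bhi * n) ≤ 1)
    (hCW : 8 * (∑ χ : D4Irrep, (G.abot χ + G.atop χ) + 1) +
        17 * (G.aplus * P.Klam ^ 2 * G.Z + G.cloc * P.Klam ^ 2 * (1 - (4 : ℝ) ^ (-G.θ))⁻¹ + 1) + 1 +
          (8 * (tG + sG) + 3 + tG) * (G.CF * P.Klam ^ 2) ≤ P.C_W) :
    PairArrayAtV2 L M P Qc β U μ K n := by
  have hdrive := drivePBar_sum_le (P := P) hG U n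
  have herem := eremBar_sum_le hG hP hQc U β L n
  have hU2 : 0 ≤ U ^ 2 := sq_nonneg U
  have hCL0 : 0 ≤ ∑ j ∈ range n, Qc.CL β j / L := sum_nonneg fun j _ => div_nonneg (hQc.2.2.2.2.2.2.2 β j) (Nat.cast_nonneg L)
  have hθ : 0 < G.θ := hG.2.2.2.2.2.1
  have hg : 0 ≤ (1 - (4 : ℝ) ^ (-G.θ))⁻¹ :=
    inv_nonneg.2 (by have := Real.rpow_lt_one_of_one_lt_of_neg (x := (4 : ℝ)) (by norm_num) (by linarith : -G.θ < 0); linarith)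
  have hK0 : 0 ≤ P.Klam := zero_le_one.trans hP.1
  have hcloc : 0 ≤ G.cloc := hG.2.2.2.2.1
  have haplus : 0 ≤ G.aplus := hG.2.2.2.2.2.2.2.2.2.2.1
  have hCF : 0 ≤ G.CF := hG.2.2.2.2.2.2.2.2.2.2.2.2.2.1
  have hCR : 0 ≤ Qc.CR := hQc.2.1
  have hbhi : 0 ≤ G.bhi := hG.2.2.1.trans hG.2.2.2.1
  have hab : 0 ≤ ∑ χ : D4Irrep, (G.abot χ + G.atop χ) := sum_nonneg fun χ _ => add_nonneg (hG.2.1 χ) (hG.1 χ)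
  have hZ : 0 ≤ G.Z := le_trans (sum_nonneg fun j _ => hG.2.2.2.2.2.2.2.2.1 j) (hG.2.2.2.2.2.2.2.2.2.1 0)
  -- the two quadratic units `g2 = CF·(Klam U)²`, `q3 = CR·Klam³·U²` and the product facts `linarith` needs
  have hg20 : 0 ≤ G.CF * (P.Klam * U) ^ 2 := by positivity
  have hq30 : 0 ≤ Qc.CR * P.Klam ^ 3 * U ^ 2 := by positivity
  have hsq : G.CF * (P.Klam * U) ^ 2 = (G.CF * P.Klam ^ 2) * U ^ 2 := by ring
  have hCRU : 2 * Qc.CR * P.Klam ^ 3 * |U| * U ^ 2 ≤ U ^ 2 := by nlinarith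
  have hS : ∑ j ∈ range n, (drivePBar G P U j + eremBar G P Qc U β L j) ≤
      (G.aplus * P.Klam ^ 2 * G.Z + G.cloc * P.Klam ^ 2 * (1 - (4 : ℝ) ^ (-G.θ))⁻¹) * U ^ 2 +
        2 * Qc.CR * P.Klam ^ 3 * |U| * U ^ 2 + ∑ j ∈ range n, Qc.CL β j / L := by
    rw [sum_add_distrib]; nlinarith [hdrive, herem]
  have hS0 : 0 ≤ ∑ j ∈ range n, (drivePBar G P U j + eremBar G P Qc U β L j) :=
    sum_nonneg fun j _ => add_nonneg (drivePBar_nonneg' hG U j) (eremBar_nonneg' hG hP hQc U β L j)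
  have hinit : initDevBar G U = (∑ χ : D4Irrep, (G.abot χ + G.atop χ) + 1) * U ^ 2 := rfl
  have hn0 : (0 : ℝ) ≤ n := Nat.cast_nonneg n
  have hSe0 : 0 ≤ ∑ i ∈ range n, eremBar G P Qc U β L i := sum_nonneg fun i _ => eremBar_nonneg' hG hP hQc U β L i
  have haKZU : 0 ≤ G.aplus * P.Klam ^ 2 * G.Z * U ^ 2 := by positivity
  have hcKgU : 0 ≤ G.cloc * P.Klam ^ 2 * (1 - (4 : ℝ) ^ (-G.θ))⁻¹ * U ^ 2 := by positivity
  have hXtot0 : 0 ≤ tG * (G.CF * (P.Klam * U) ^ 2) + tQ * (Qc.CR * P.Klam ^ 3 * U ^ 2) := by positivity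
  have hXsup0 : 0 ≤ sG * (G.CF * (P.Klam * U) ^ 2) + sQ * (Qc.CR * P.Klam ^ 3 * U ^ 2) := by positivity
  -- the no-onset line
  have hsm : 8 * 20 * ((initDevBar G U + ∑ j ∈ range n, (drivePBar G P U j + eremBar G P Qc U β L j) +
          (tG * (G.CF * (P.Klam * U) ^ 2) + tQ * (Qc.CR * P.Klam ^ 3 * U ^ 2))) +
        (∑ j ∈ range n, (drivePBar G P U j + eremBar G P Qc U β L j) +
          (sG * (G.CF * (P.Klam * U) ^ 2) + sQ * (Qc.CR * P.Klam ^ 3 * U ^ 2)))) * (G.bhi * n) ≤ 1 := by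
    refine le_trans ?_ hsmall
    have hmain : (initDevBar G U + ∑ j ∈ range n, (drivePBar G P U j + eremBar G P Qc U β L j) +
          (tG * (G.CF * (P.Klam * U) ^ 2) + tQ * (Qc.CR * P.Klam ^ 3 * U ^ 2))) +
        (∑ j ∈ range n, (drivePBar G P U j + eremBar G P Qc U β L j) +
          (sG * (G.CF * (P.Klam * U) ^ 2) + sQ * (Qc.CR * P.Klam ^ 3 * U ^ 2))) ≤
        ((∑ χ : D4Irrep, (G.abot χ + G.atop χ) + 1) +
          2 * (G.aplus * P.Klam ^ 2 * G.Z + G.cloc * P.Klam ^ 2 * (1 - (4 : ℝ) ^ (-G.θ))⁻¹ + 1) + 1 +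
            (tG + sG) * (G.CF * P.Klam ^ 2) + (tQ + sQ) * (Qc.CR * P.Klam ^ 3)) * U ^ 2 := by
      rw [hinit]
      linarith [hS, hCRU, hL, hCL0, hsq, hU2]
    have h0' : 0 ≤ (initDevBar G U + ∑ j ∈ range n, (drivePBar G P U j + eremBar G P Qc U β L j) +
          (tG * (G.CF * (P.Klam * U) ^ 2) + tQ * (Qc.CR * P.Klam ^ 3 * U ^ 2))) +
        (∑ j ∈ range n, (drivePBar G P U j + eremBar G P Qc U β L j) +
          (sG * (G.CF * (P.Klam * U) ^ 2) + sQ * (Qc.CR * P.Klam ^ 3 * U ^ 2))) := by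
      rw [hinit]; positivity
    exact mul_le_mul_of_nonneg_right (mul_le_mul_of_nonneg_left hmain (by norm_num)) (mul_nonneg hbhi hn0)
  -- the tolerance line: `16·S + Σē ≤ (17(aKZ + cKg) + 18)·U²`, the `g2`/`q3` numerals, `C_W`, `klLegKappa`
  have herem' : ∑ i ∈ range n, eremBar G P Qc U β L i ≤
      G.cloc * P.Klam ^ 2 * (1 - (4 : ℝ) ^ (-G.θ))⁻¹ * U ^ 2 + 2 * Qc.CR * P.Klam ^ 3 * |U| * U ^ 2 +
        ∑ j ∈ range n, Qc.CL β j / L := by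
    have := herem; linarith
  have hT1 : 16 * ∑ j ∈ range n, (drivePBar G P U j + eremBar G P Qc U β L j) + ∑ i ∈ range n, eremBar G P Qc U β L i ≤
      17 * (G.aplus * P.Klam ^ 2 * G.Z * U ^ 2 + G.cloc * P.Klam ^ 2 * (1 - (4 : ℝ) ^ (-G.θ))⁻¹ * U ^ 2) + 18 * U ^ 2 := by
    linarith [hS, herem', hCRU, hL, hCL0, haKZU]
  have hCWU := mul_le_mul_of_nonneg_right hCW hU2
  have hκq : (8 * (tQ + sQ) + tQ) * (Qc.CR * P.Klam ^ 3 * U ^ 2) ≤ klLegKappa * (Qc.CR * P.Klam ^ 3 * U ^ 2) :=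
    mul_le_mul_of_nonneg_right hκ hq30
  intro Qm
  obtain ⟨u, hu0, huU, hu⟩ := pairArray_envelope_extra L M hG hP hQc hU X
    (Xtot := tG * (G.CF * (P.Klam * U) ^ 2) + tQ * (Qc.CR * P.Klam ^ 3 * U ^ 2))
    (Xsup := sG * (G.CF * (P.Klam * U) ^ 2) + sQ * (Qc.CR * P.Klam ^ 3 * U ^ 2)) hX0 hXtot0 hXsup0
    hXsup hXsum hXtot h0 hsteps hincr Qm hsm
  refine ⟨u, hu0, huU.trans (by rw [abs_of_nonneg hU]; linarith), fun k hk k' hk' => (hu k hk k' hk').trans ?_⟩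
  rw [hinit]
  linarith [hT1, hCWU, hκq, hq30, hg20, hS0, hSe0, hsq]

end Model

/-! ## The child-1 theorem, generic in the extra family -/

/-- **Child 1 for every bundle and window, GENERIC in the (T)/(D) extra-majorant family.**  Numerals `sG sQ tG tQ ≥ 0` with
`8(tQ+sQ)+tQ ≤ klLegKappa`; a family `𝔛 L G P Q β U μ K j Qm k k'` that is `≥ 0`, `≤ sG·CF(Klam U)² + sQ·CR·Klam³·U²` per scale and whose scale
sums (`Σ_{j ∈ (t,n]}`, `Σ_{i<n} (i+1)`) are `≤ tG·CF(Klam U)² + tQ·CR·Klam³·U²` for `n ≤ n_β`, whenever `G, P, Q` are well formed, `0 ≤ U`,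
`|U| ≤ 1`; a bundle whose split slot is implied by `BetaSplitAtS2` and whose engine slot yields the UV clause (at `n = 0`), the expanded ladder
and increment clauses around `𝔛` (at `n ≥ 1`), (E4) and (E5-S).  THEN `BetaSplitP Pr W`. -/
theorem betaSplitP_of_extraClauses {Pr : Preds} {W : Set ℝ} {sG sQ tG tQ : ℝ} (hsG : 0 ≤ sG) (hsQ : 0 ≤ sQ) (htG : 0 ≤ tG)
    (htQ : 0 ≤ tQ) (hκ : 8 * (tQ + sQ) + tQ ≤ klLegKappa)
    (𝔛 : ∀ (L : ℕ), GeoConsts → SplitConsts → EngConsts → ℝ → ℝ → ℝ → TrigPolyC4v → ℕ →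
      TorusSite 2 L → TorusSite 2 L → TorusSite 2 L → ℝ)
    (h𝔛0 : ∀ (L : ℕ) (G : GeoConsts) (P : SplitConsts) (Q : EngConsts) (β U μ : ℝ) (K : TrigPolyC4v) (j : ℕ)
      (Qm k k' : TorusSite 2 L), G.WF → P.WF → Q.WF → 0 ≤ 𝔛 L G P Q β U μ K j Qm k k')
    (h𝔛sup : ∀ (L : ℕ) (G : GeoConsts) (P : SplitConsts) (Q : EngConsts) (β U μ : ℝ) (K : TrigPolyC4v) (j : ℕ)
      (Qm k k' : TorusSite 2 L), G.WF → P.WF → Q.WF → 0 ≤ U → |U| ≤ 1 →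
        𝔛 L G P Q β U μ K j Qm k k' ≤ sG * (G.CF * (P.Klam * U) ^ 2) + sQ * (Q.CR * P.Klam ^ 3 * U ^ 2))
    (h𝔛sum : ∀ (L : ℕ) (G : GeoConsts) (P : SplitConsts) (Q : EngConsts) (β U μ : ℝ) (K : TrigPolyC4v) (t n : ℕ)
      (Qm k k' : TorusSite 2 L), G.WF → P.WF → Q.WF → 0 ≤ U → |U| ≤ 1 → n ≤ nScales β →
        ∑ j ∈ Ioc t n, 𝔛 L G P Q β U μ K j Qm k k' ≤ tG * (G.CF * (P.Klam * U) ^ 2) + tQ * (Q.CR * P.Klam ^ 3 * U ^ 2))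
    (h𝔛tot : ∀ (L : ℕ) (G : GeoConsts) (P : SplitConsts) (Q : EngConsts) (β U μ : ℝ) (K : TrigPolyC4v) (n : ℕ)
      (Qm k k' : TorusSite 2 L), G.WF → P.WF → Q.WF → 0 ≤ U → |U| ≤ 1 → n ≤ nScales β →
        ∑ i ∈ range n, 𝔛 L G P Q β U μ K (i + 1) Qm k k' ≤ tG * (G.CF * (P.Klam * U) ^ 2) + tQ * (Q.CR * P.Klam ^ 3 * U ^ 2))
    (hs : ∀ (L M : ℕ) [NeZero L] [NeZero M] (G : GeoConsts) (P : SplitConsts) (Q : EngConsts) (β U μ : ℝ) (K : TrigPolyC4v) (n : ℕ),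
      BetaSplitAtS2 L M G P Q β U μ K n → Pr.split L M G P Q β U μ K n)
    (he : ∀ (L M : ℕ) [NeZero L] [NeZero M] (G : GeoConsts) (P : SplitConsts) (Q : EngConsts) (β U μ : ℝ) (K : TrigPolyC4v) (n : ℕ),
      Pr.engine L M G P Q β U μ K n →
        (n = 0 → ∀ Qm : TorusSite 2 L, ∀ k ∈ klBall L μ K, ∀ k' ∈ klBall L μ K,
          ‖klPairAmplitude L M β U μ K 0 Qm k k' - (U : ℂ)‖ ≤ initDevBar G U) ∧
        (1 ≤ n → ∀ Qm : TorusSite 2 L, IsPairClassAt L Qm n →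
          ∃ w : TorusSite 2 L → ℝ, (∀ p, 0 ≤ w p) ∧ (∑ p, w p ≤ G.bhi) ∧
            ∃ N : Matrix (TorusSite 2 L) (TorusSite 2 L) ℂ,
              (1 + Matrix.diagonal (fun p => (w p : ℂ)) * klPairArray L M β U μ K (n - 1) Qm) * N = 1 ∧
              ∀ k ∈ klBall L μ K, ∀ k' ∈ klBall L μ K,
                ‖klPairAmplitude L M β U μ K n Qm k k' - (klPairArray L M β U μ K (n - 1) Qm * N) k k'‖ ≤
                  drivePBar G P U (n - 1) + eremBar G P Q U β L (n - 1) + 𝔛 L G P Q β U μ K n Qm k k') ∧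
        (1 ≤ n → ∀ Qm : TorusSite 2 L, ∀ k ∈ klBall L μ K, ∀ k' ∈ klBall L μ K,
          ‖klPairAmplitude L M β U μ K n Qm k k' - klPairAmplitude L M β U μ K (n - 1) Qm k k'‖ ≤
            gainBar G P U n (klTorusNorm L Qm) (klTorusNorm L (k - k')) (klTorusNorm L (k + k' - Qm)) +
              eremBar G P Q U β L (n - 1) + 𝔛 L G P Q β U μ K n Qm k k') ∧
        EngineFirstMoments L M G P Q β U μ K n ∧ IsoTupleL1AtS L M G P β U μ K n) :
    BetaSplitP Pr W := by
  intro G hG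
  -- nonnegativity of the `G`-constants
  have hCF : 0 ≤ G.CF := hG.2.2.2.2.2.2.2.2.2.2.2.2.2.1
  have hcloc : 0 ≤ G.cloc := hG.2.2.2.2.1
  have haplus : 0 ≤ G.aplus := hG.2.2.2.2.2.2.2.2.2.2.1
  have hθ : 0 < G.θ := hG.2.2.2.2.2.1
  have hbhi : 0 ≤ G.bhi := le_trans hG.2.2.1 hG.2.2.2.1
  have hcE4 : 0 ≤ G.cE4 := hG.2.2.2.2.2.2.2.2.2.2.2.2.2.2.2.2.1
  have hZ : 0 ≤ G.Z := le_trans (sum_nonneg fun j _ => hG.2.2.2.2.2.2.2.2.1 j) (hG.2.2.2.2.2.2.2.2.2.1 0)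
  have hab : 0 ≤ ∑ χ : D4Irrep, (G.abot χ + G.atop χ) := sum_nonneg fun χ _ => add_nonneg (hG.2.1 χ) (hG.1 χ)
  have hg : 0 ≤ (1 - (4 : ℝ) ^ (-G.θ))⁻¹ :=
    inv_nonneg.2 (by have := Real.rpow_lt_one_of_one_lt_of_neg (x := (4 : ℝ)) (by norm_num) (by linarith : -G.θ < 0); linarith)
  -- the induction constants `P` (kept opaque)
  obtain ⟨Klam, hKlam⟩ : ∃ x : ℝ, x = 2 * G.CF + 3 := ⟨_, rfl⟩
  have hKlam1 : 1 ≤ Klam := by rw [hKlam]; linarith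
  have hKlam0 : 0 ≤ Klam := zero_le_one.trans hKlam1
  have hK2 : 0 ≤ Klam ^ 2 := sq_nonneg _
  have hx1 : 0 ≤ G.aplus * Klam ^ 2 * G.Z := mul_nonneg (mul_nonneg haplus hK2) hZ
  have hx2 : 0 ≤ G.cloc * Klam ^ 2 * (1 - (4 : ℝ) ^ (-G.θ))⁻¹ := mul_nonneg (mul_nonneg hcloc hK2) hg
  have hnum : 0 ≤ 8 * (tG + sG) + 3 + tG := by positivity
  obtain ⟨CW, hCW⟩ : ∃ x : ℝ, x = 8 * (∑ χ : D4Irrep, (G.abot χ + G.atop χ) + 1) +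
      17 * (G.aplus * Klam ^ 2 * G.Z + G.cloc * Klam ^ 2 * (1 - (4 : ℝ) ^ (-G.θ))⁻¹ + 1) + 1 +
        (8 * (tG + sG) + 3 + tG) * (G.CF * Klam ^ 2) := ⟨_, rfl⟩
  have hCW0 : 0 ≤ CW := by rw [hCW]; positivity
  refine ⟨⟨Klam, CW, G.cE4 + 1, 0⟩, ⟨hKlam1, hCW0, by positivity⟩, ?_⟩
  intro Q hQ
  have hPWF : (⟨Klam, CW, G.cE4 + 1, 0⟩ : SplitConsts).WF := ⟨hKlam1, hCW0, by positivity⟩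
  have hCR : 0 ≤ Q.CR := hQ.2.1
  have hQcE4 : 0 ≤ Q.cE4 := hQ.2.2.2.1
  have hCL : ∀ β n, 0 ≤ Q.CL β n := hQ.2.2.2.2.2.2.2
  -- the no-onset constant `c₀` (after `Q`: it reads `Q.CR`)
  obtain ⟨Crow, hCrow_def⟩ : ∃ x : ℝ, x = (∑ χ : D4Irrep, (G.abot χ + G.atop χ) + 1) +
      2 * (G.aplus * Klam ^ 2 * G.Z + G.cloc * Klam ^ 2 * (1 - (4 : ℝ) ^ (-G.θ))⁻¹ + 1) + 1 + (tG + sG) * (G.CF * Klam ^ 2) +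
        (tQ + sQ) * (Q.CR * Klam ^ 3) := ⟨_, rfl⟩
  have hK3 : 0 ≤ Q.CR * Klam ^ 3 := by positivity
  have hCrow1 : 1 ≤ Crow := by
    rw [hCrow_def]; nlinarith [mul_nonneg hCF hK2, mul_nonneg (add_nonneg htG hsG) (mul_nonneg hCF hK2),
      mul_nonneg (add_nonneg htQ hsQ) hK3]
  have hCrow : 0 ≤ Crow := zero_le_one.trans hCrow1
  have hlog4 : 0 < Real.log 4 := Real.log_pos (by norm_num)
  refine ⟨Real.log 4 / (160 * Crow * (G.bhi + 1)), by positivity, ?_⟩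
  intro c hc hcc₀ R hR
  -- `U₀`
  obtain ⟨CW', hCW'_def⟩ : ∃ x : ℝ, x = CW + klLegKappa * Q.CR * Klam ^ 3 := ⟨_, rfl⟩
  have hκ0 : 0 ≤ klLegKappa := by unfold klLegKappa; norm_num
  have hCW'0 : 0 ≤ CW' := by
    rw [hCW'_def]; exact add_nonneg hCW0 (mul_nonneg (mul_nonneg hκ0 hCR) (pow_nonneg hKlam0 3))
  obtain ⟨Dval, hDval_def⟩ : ∃ x : ℝ, x = CW' + G.CF * CW' + G.CF * Klam ^ 2 := ⟨_, rfl⟩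
  have hDval : 0 ≤ Dval := by
    rw [hDval_def]; exact add_nonneg (add_nonneg hCW'0 (mul_nonneg hCF hCW'0)) (mul_nonneg hCF hK2)
  obtain ⟨U₀, hU₀_def⟩ : ∃ x : ℝ, x = min 1 (min (1 / (2 * Q.CR * Klam ^ 3 + 1)) (min (1 / (Q.cE4 + 1)) (1 / (Dval + 1)))) :=
    ⟨_, rfl⟩
  have hU₀ : 0 < U₀ := by
    rw [hU₀_def]
    exact lt_min one_pos (lt_min (by positivity) (lt_min (by positivity) (by positivity)))
  refine ⟨U₀, hU₀, fun β U => ⌈17 * (∑ j ∈ range (nScales β + 1), Q.CL β j) / U ^ 2⌉₊, fun _ _ _ => 0, ?_⟩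
  intro μ hμ U hU hUle β hβmin hβc K hK L M _ _ hL hM n hn hKL hHist hE hT
  -- the smallness lines out of `U ≤ U₀`
  rw [hU₀_def] at hUle
  have hU1 : U ≤ 1 := hUle.trans (min_le_left _ _)
  have hUa : |U| = U := abs_of_pos hU
  have hUa1 : |U| ≤ 1 := by rw [hUa]; exact hU1
  have hUCR : 2 * Q.CR * Klam ^ 3 * |U| ≤ 1 := by
    rw [hUa]
    exact klbs_mul_le_one_of_le_inv (by positivity) hU.le (hUle.trans ((min_le_right _ _).trans (min_le_left _ _)))
  have hUcE4 : Q.cE4 * |U| ≤ 1 := by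
    rw [hUa]
    exact klbs_mul_le_one_of_le_inv hQcE4 hU.le
      (hUle.trans ((min_le_right _ _).trans ((min_le_right _ _).trans (min_le_left _ _))))
  have hUD : Dval * U ≤ 1 :=
    klbs_mul_le_one_of_le_inv hDval hU.le
      (hUle.trans ((min_le_right _ _).trans ((min_le_right _ _).trans (min_le_right _ _))))
  have hc' : 160 * Crow * (G.bhi + 1) * c ≤ Real.log 4 := by
    have hpos : 0 < 160 * Crow * (G.bhi + 1) := by positivity
    have := (le_div_iff₀ hpos).1 hcc₀
    linarith
  -- the engine clauses at every scale `j ≤ n` (history + the scale-`n` hypothesis)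
  have hEn := he L M G (⟨Klam, CW, G.cE4 + 1, 0⟩ : SplitConsts) Q β U μ K n hE
  have hEall : ∀ j ≤ n,
      (j = 0 → ∀ Qm : TorusSite 2 L, ∀ k ∈ klBall L μ K, ∀ k' ∈ klBall L μ K,
          ‖klPairAmplitude L M β U μ K 0 Qm k k' - (U : ℂ)‖ ≤ initDevBar G U) ∧
        (1 ≤ j → ∀ Qm : TorusSite 2 L, IsPairClassAt L Qm j →
          ∃ w : TorusSite 2 L → ℝ, (∀ p, 0 ≤ w p) ∧ (∑ p, w p ≤ G.bhi) ∧
            ∃ N : Matrix (TorusSite 2 L) (TorusSite 2 L) ℂ,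
              (1 + Matrix.diagonal (fun p => (w p : ℂ)) * klPairArray L M β U μ K (j - 1) Qm) * N = 1 ∧
              ∀ k ∈ klBall L μ K, ∀ k' ∈ klBall L μ K,
                ‖klPairAmplitude L M β U μ K j Qm k k' - (klPairArray L M β U μ K (j - 1) Qm * N) k k'‖ ≤
                  drivePBar G (⟨Klam, CW, G.cE4 + 1, 0⟩ : SplitConsts) U (j - 1) + eremBar G (⟨Klam, CW, G.cE4 + 1, 0⟩ : SplitConsts) Q U β L (j - 1) + 𝔛 L G (⟨Klam, CW, G.cE4 + 1, 0⟩ : SplitConsts) Q β U μ K j Qm k k') ∧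
        (1 ≤ j → ∀ Qm : TorusSite 2 L, ∀ k ∈ klBall L μ K, ∀ k' ∈ klBall L μ K,
          ‖klPairAmplitude L M β U μ K j Qm k k' - klPairAmplitude L M β U μ K (j - 1) Qm k k'‖ ≤
            gainBar G (⟨Klam, CW, G.cE4 + 1, 0⟩ : SplitConsts) U j (klTorusNorm L Qm) (klTorusNorm L (k - k')) (klTorusNorm L (k + k' - Qm)) +
              eremBar G (⟨Klam, CW, G.cE4 + 1, 0⟩ : SplitConsts) Q U β L (j - 1) + 𝔛 L G (⟨Klam, CW, G.cE4 + 1, 0⟩ : SplitConsts) Q β U μ K j Qm k k') := by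
    intro j hj
    rcases Nat.lt_or_ge j n with hlt | hge
    · have h := he L M G (⟨Klam, CW, G.cE4 + 1, 0⟩ : SplitConsts) Q β U μ K j (hHist j hlt).2.2.1
      exact ⟨h.1, h.2.1, h.2.2.1⟩
    · have : j = n := le_antisymm hj hge
      subst this
      exact ⟨hEn.1, hEn.2.1, hEn.2.2.1⟩
  -- (B1-v2′) from the generic row 0′, in the regime
  have hLline : 17 * ∑ j ∈ range n, Q.CL β j / L ≤ U ^ 2 := klbs_volume_line hCL hU hn hL
  have hsmall : 8 * 20 * (((∑ χ : D4Irrep, (G.abot χ + G.atop χ) + 1) +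
      2 * (G.aplus * Klam ^ 2 * G.Z + G.cloc * Klam ^ 2 * (1 - (4 : ℝ) ^ (-G.θ))⁻¹ + 1) + 1 + (tG + sG) * (G.CF * Klam ^ 2) +
        (tQ + sQ) * (Q.CR * Klam ^ 3)) * U ^ 2) * (G.bhi * n) ≤ 1 := by
    rw [← hCrow_def]; exact klbs_noOnset_line hCrow hbhi hKL hc'
  have hB1 : PairArrayAtV2 L M (⟨Klam, CW, G.cE4 + 1, 0⟩ : SplitConsts) Q β U μ K n :=
    pairArrayAtV2_of_extraClauses_explicit L M hG hPWF hQ hU.le hsG hsQ htG htQ hκ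
      (fun j Qm k k' => 𝔛 L G (⟨Klam, CW, G.cE4 + 1, 0⟩ : SplitConsts) Q β U μ K j Qm k k')
      (fun j Qm k k' => h𝔛0 L G (⟨Klam, CW, G.cE4 + 1, 0⟩ : SplitConsts) Q β U μ K j Qm k k' hG hPWF hQ)
      (fun j Qm k k' => h𝔛sup L G (⟨Klam, CW, G.cE4 + 1, 0⟩ : SplitConsts) Q β U μ K j Qm k k' hG hPWF hQ hU.le hUa1)
      (fun t Qm k k' => h𝔛sum L G (⟨Klam, CW, G.cE4 + 1, 0⟩ : SplitConsts) Q β U μ K t n Qm k k' hG hPWF hQ hU.le hUa1 hn)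
      (fun Qm k k' => h𝔛tot L G (⟨Klam, CW, G.cE4 + 1, 0⟩ : SplitConsts) Q β U μ K n Qm k k' hG hPWF hQ hU.le hUa1 hn)
      ((hEall 0 (Nat.zero_le n)).1 rfl)
      (fun j hj1 hjn => (hEall j hjn).2.1 hj1) (fun j hj1 hjn => (hEall j hjn).2.2 hj1)
      hUCR hLline hsmall (by rw [hCW])
  -- the per-scale step: value line, iso endpoint line, first moments
  have hUD' : (CW' + G.CF * CW' + G.CF * Klam ^ 2) * U ≤ 1 := by rwa [hDval_def] at hUD
  obtain ⟨hKval, harith⟩ := klbs_value_consts hCF hCW'0 hKlam hU.le hUD'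
  have hB : BetaSplitAtS2 L M G (⟨Klam, CW, G.cE4 + 1, 0⟩ : SplitConsts) Q β U μ K n := by
    have hB0 : 0 ≤ 2 * |U| + (CW + klLegKappa * Q.CR * Klam ^ 3) * U ^ 2 := by
      rw [← hCW'_def]; exact add_nonneg (mul_nonneg zero_le_two (abs_nonneg U)) (mul_nonneg hCW'0 (sq_nonneg U))
    refine betaSplitAtS2_of_pairArrayAtV2 L M (⟨Klam, CW, G.cE4 + 1, 0⟩ : SplitConsts) Q hB0 hKlam0 hB1 hEn.2.2.2.2 hEn.2.2.2.1 ?_ ?_ ?_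
    · show G.CF * (2 * |U| + (CW + klLegKappa * Q.CR * Klam ^ 3) * U ^ 2) + G.CF * (Klam * U) ^ 2 ≤ Klam * |U|
      rw [hUa, ← hCW'_def]; exact harith
    · show 2 * |U| + (CW + klLegKappa * Q.CR * Klam ^ 3) * U ^ 2 ≤ Klam * |U|
      rw [hUa, ← hCW'_def]; exact hKval
    · show G.cE4 + Q.cE4 * |U| ≤ G.cE4 + 1
      linarith
  exact hs L M G _ Q β U μ K n hB

end Summit.HubbardSuperconductivity.HubbardSuperconductivity.Theorems.KLRegimeSplit

end
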